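import Summits.QuantumFields.YangMills.Theorems.AllWindowsColdBoxBoxHighLineK4PrimeRowSum
import Summits.QuantumFields.YangMills.Theorems.AllWindowsColdBoxBoxHighLineK4PrimeRowR3R4
import Summits.QuantumFields.YangMills.Theorems.AllWindowsColdBoxBoxHighLineConnectedFourPointCrossOddEven

/-!
# U5 K4′ — the ROW SUM, part 2: the per-row `hKk` adapters of the remaining rows (R3, R6/7 …) BY NAME
# (planner ym-idea-2 g18 GO 2026-08-30T01:16:10Z «then hK4 BY NAME = tiltCum4_cutSet_size_of_rows A2 A3 A4 A67»; LINE-20 U5 ⟨stmt-QuantumFields-24336⟩ —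
# U5 prep, helper-grade)

Extra width seat `ym-line-sfw-p2-w4` (g30).  Part 1 (✓`…K4PrimeRowSum`) proved `tiltCum4_cutSet_size_of_rows (hR3) (hR4) (hR67) : <hK4>` with R1, R2, R5 and
LEAD's composition by name.  This file discharges the remaining row hypotheses, one adapter per landed row, each from the row owner's Gaussian-letter
statement to the per-row `hKk` currency (point of record `κ₃ = 1/8 − θ/4`, `s = β^{(1/8−θ/4)−1/2}`, top slab `β^θ ≤ H ≤ β^θ + 1`):

* ★ `K4RowSum.rowBound_R3` — row R3 `κ₄(c_x,c_y;N′)` for the record tensor, from w2 g33's ✓`GaussNormalForm.abs_tiltCum4_muSet_rowR3_le` (generic `N`, `ν`)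
  at `N′ := Uᵒ − P`, `ν := C₀·H⁶(1+log H)^m·s³ + Cr·β·H⁴·s⁵` (ν-supplier: w2's ✓`abs_tiltU_odd_add_cubicVertex_le` + the record remainder); `q₃ := 0`; budget rows
  `H²⁰L^{2m}s¹⁰β²` (`35θ/2 < 7/4`), `H¹⁸L^m s¹²β³` (`15θ < 3/2`), `H¹⁶s¹⁴β⁴` (`25θ/2 < 5/4`) — all strict exactly on `θ < 1/10` (the quintic remainder
  `Cr·β·H⁴·s⁵` dominates `ν` in the HIGH window; it is what makes the last row tight).

* ★ `K4RowSum.rowBound_R67` — rows R6/7 (the Uᵒ/Uᵉ CROSS term), from LEAD g78's ✓`GaussNormalForm.abs_cross_muSet_chartPlaqCost_tiltU_parity_le`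
  (`K := 2`); `q₆ := 0`; budget via the eventual dominations `H¹²s⁶, H⁸s⁸ ≤ H⁴/β, H⁸/β²` and the two monomials `H¹³L^m s²β^{(3/2)(κ₃−1/2)}`
  (`97θ/8 < 21/16`) and `H¹⁴L^m s²/β` (`27θ/2 < 7/4`).

(Row R4 — in the fourth-moment form R4′, see the bus 2026-08-30T01:19:50Z/01:20:54Z — follows by the append protocol when it lands; then
`hK4 := tiltCum4_cutSet_size_of_rows rowBound_R3 rowBound_R4 rowBound_R67`.)

No definitions; tree only; standard axioms.  HONEST LABEL: helper-grade bookkeeping for the UNSTAFFED stub U5 — `hK4` is NOT yet proved (R4′, R6/7 open);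
U5 `stub_landauThirdOrder`, ⟨24336⟩, ⟨24004⟩ and this seat's crux ⟨stmt-QuantumFields-22884⟩ remain OPEN; route AllWindowsColdBox is DRAFT; no crux, rung or
summit is proved; **the Yang–Mills mass gap is NOT proved by this file; no summit is proved by a line.**
-/

set_option autoImplicit false

noncomputable section

open MeasureTheory
open Literature.Probability.LatticeModels (Site)
open Literature.MathematicalPhysics.QuantumLattice (ZdPlaquette plaquettesTouching)
open Literature.MathematicalPhysics.QuantumFieldTheory.AxialGauge (boxEdges)
open Summit.QuantumFields.YangMills.Theorems.WeakCouplingRates (plaq12At)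

namespace Summit.QuantumFields.YangMills.Theorems.AllWindowsColdBoxBoxHighLine

namespace K4RowSum

open AssemblyBudget ErrorBudget

/-- ★ **Row R3 (the odd-remainder slot `κ₄(c_x,c_y;N′)`) in the per-row `hKk` currency**, for every bounded tensor `Tc` whose triple-form sum approximates
`−cubicVertex` to quintic order on small fields: from w2 g33's ✓`GaussNormalForm.abs_tiltCum4_muSet_rowR3_le` at `N′ := Uᵒ − P`,
`sup_D |N′| ≤ C₀·H⁶(1+log H)^m·s³ + Cr·β·H⁴·s⁵` (✓`GaussNormalForm.abs_tiltU_odd_add_cubicVertex_le` and the remainder hypothesis). -/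
theorem rowBound_R3 : ∀ θ : ℝ, 0 < θ → θ < 1 / 10 → ∀ B Cr : ℝ, ∀ Tc : ZdPlaquette 4 → Fin 4 → Fin 4 → Fin 4 → ℝ, (∀ p i j k, |Tc p i j k| ≤ B) →
    (∀ H : ℕ, 1 ≤ H → ∀ β : ℝ, 0 < β → ∀ s : ℝ, 0 ≤ s → ∀ a ∈ smallField H s,
      |cubicVertex β H a + β * ∑ p ∈ plaquettesTouching (boxEdges 4 (2 * H + 1)), tripleForm (Tc p) (plaqVar H p.1 p.2.1.1 p.2.1.2 a)| ≤
        Cr * β * (H : ℝ) ^ 4 * s ^ 5) →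
    ∃ q : ℝ, ∃ K : ℝ → ℕ → ℝ,
    (∃ β₀ : ℝ, 1 ≤ β₀ ∧ ∀ β : ℝ, β₀ ≤ β → ∀ H : ℕ, 1 ≤ H → β ^ θ ≤ (H : ℝ) → (H : ℝ) ≤ β ^ θ + 1 →
      ∀ D : Set (LandauFree H → E3), MeasurableSet D → D ⊆ smallField H (β ^ ((1 / 8 - θ / 4) - 1 / 2)) → (∀ a, -a ∈ D ↔ a ∈ D) →
      gaussAvg β H (fun a => 1 - D.indicator (fun _ => (1 : ℝ)) a) ≤ β ^ (-q) →
      gaussAvg β H (fun a => 1 - D.indicator (fun _ => (1 : ℝ)) a) ≤ 1 / 2 → (∀ a ∈ D, |tiltU β H a| ≤ 2) → ∀ x y : Site 4,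
      |Tilt.tiltCum4 (((volume : Measure (LandauFree H → E3)).restrict D).withDensity fun a => ENNReal.ofReal (gaussWeight β H a))
          (fun a => (tiltU β H a - tiltU β H (-a)) / 2 -
            β * ∑ p ∈ plaquettesTouching (boxEdges 4 (2 * H + 1)), tripleForm (Tc p) (plaqVar H p.1 p.2.1.1 p.2.1.2 a)) 0
          (chartPlaqCost H x 1 2) (chartPlaqCost H y 1 2)| ≤ K β H) ∧
    (∀ ε : ℝ, 0 < ε → ∃ β₀ : ℝ, 1 ≤ β₀ ∧ ∀ β : ℝ, β₀ ≤ β → ∀ H : ℕ, 1 ≤ H → (H : ℝ) ≤ β ^ θ + 1 → β ^ 2 * (H : ℝ) ^ 8 * K β H ≤ ε) := by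
  intro θ hθ hθ' B Cr Tc hTc hrem
  obtain ⟨C₀, c₀, m, hC₀, hc₀, hG⟩ := GaussNormalForm.abs_tiltU_odd_add_cubicVertex_le
  have hCr : 0 ≤ Cr := by
    -- read off at `H = 1`, `β = 1`, `s = 1`, `a = 0`
    have h := hrem 1 le_rfl 1 one_pos 1 zero_le_one 0 (fun e => by simp)
    have : (0 : ℝ) ≤ Cr * 1 * ((1 : ℕ) : ℝ) ^ 4 * 1 ^ 5 := (abs_nonneg _).trans h
    simpa using this
  obtain ⟨b₀, hb₀, hside⟩ := side_budget (κ₃ := 1 / 8 - θ / 4) (c := c₀) hθ (by linarith) (by linarith) hc₀ 0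
  refine ⟨0, fun β H => 128 * (116 * (β ^ ((1 / 8 - θ / 4) - 1 / 2)) ^ 2) ^ 2 *
      (C₀ * (H : ℝ) ^ 6 * (1 + Real.log H) ^ m * (β ^ ((1 / 8 - θ / 4) - 1 / 2)) ^ 3 + Cr * β * (H : ℝ) ^ 4 * (β ^ ((1 / 8 - θ / 4) - 1 / 2)) ^ 5) ^ 2,
    ⟨b₀, hb₀, ?_⟩, ?_⟩
  · intro β hβ H hH hHl hHu D hDm hDs hsym _ hco2 hU x y
    obtain ⟨-, hsH, -, -, hs1⟩ := hside β hβ H hH hHl hHu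
    have hβ0 : 0 < β := by linarith
    set s : ℝ := β ^ ((1 / 8 - θ / 4) - 1 / 2) with hs
    have hs0 : 0 ≤ s := Real.rpow_nonneg hβ0.le _
    have hH1 : (1 : ℝ) ≤ H := by exact_mod_cast hH
    have hL0 : 0 ≤ 1 + Real.log (H : ℝ) := by have := Real.log_nonneg hH1; linarith
    -- measurability of `N′`
    have mP : Measurable fun a : LandauFree H → E3 =>
        β * ∑ p ∈ plaquettesTouching (boxEdges 4 (2 * H + 1)), tripleForm (Tc p) (plaqVar H p.1 p.2.1.1 p.2.1.2 a) :=
      EdgeChartGaussian.measurable_of_polyCert (EdgeChartGaussian.polyCert_tripleFormSum H β _ Tc hTc)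
    have mN : Measurable fun a : LandauFree H → E3 => (tiltU β H a - tiltU β H (-a)) / 2 -
        β * ∑ p ∈ plaquettesTouching (boxEdges 4 (2 * H + 1)), tripleForm (Tc p) (plaqVar H p.1 p.2.1.1 p.2.1.2 a) :=
      (((GaussNormalForm.measurable_tiltU β H).sub ((GaussNormalForm.measurable_tiltU β H).comp measurable_neg)).div_const 2).sub mP
    -- the sup of `N′` on `D`
    have hν0 : 0 ≤ C₀ * (H : ℝ) ^ 6 * (1 + Real.log H) ^ m * s ^ 3 + Cr * β * (H : ℝ) ^ 4 * s ^ 5 := by positivity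
    have bN : ∀ a ∈ D, |(tiltU β H a - tiltU β H (-a)) / 2 -
        β * ∑ p ∈ plaquettesTouching (boxEdges 4 (2 * H + 1)), tripleForm (Tc p) (plaqVar H p.1 p.2.1.1 p.2.1.2 a)| ≤
        C₀ * (H : ℝ) ^ 6 * (1 + Real.log H) ^ m * s ^ 3 + Cr * β * (H : ℝ) ^ 4 * s ^ 5 := by
      intro a ha
      have h1 := hG H hH β s hs0 hsH a (hDs ha)
      have h2 := hrem H hH β hβ0 s hs0 a (hDs ha)
      have hid : (tiltU β H a - tiltU β H (-a)) / 2 -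
          β * ∑ p ∈ plaquettesTouching (boxEdges 4 (2 * H + 1)), tripleForm (Tc p) (plaqVar H p.1 p.2.1.1 p.2.1.2 a) =
          ((tiltU β H a - tiltU β H (-a)) / 2 + cubicVertex β H a) -
            (cubicVertex β H a + β * ∑ p ∈ plaquettesTouching (boxEdges 4 (2 * H + 1)), tripleForm (Tc p) (plaqVar H p.1 p.2.1.1 p.2.1.2 a)) := by
        ring
      rw [hid]
      exact (abs_sub _ _).trans (add_le_add h1 h2)
    exact GaussNormalForm.abs_tiltCum4_muSet_rowR3_le hβ0 hs0 hs1 hDm hDs hco2 le_rfl mN hν0 bN x y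
  · intro ε hε
    have hε' : 0 < ε / 3 := by positivity
    obtain h₁ := budget_monomial (a := 2) (k := 20) (j := 10) (κ₃ := 1 / 8 - θ / 4) hθ.le (by push_cast; linarith) hε'
      (128 * 116 ^ 2 * C₀ ^ 2) (2 * m)
    obtain h₂ := budget_monomial (a := 3) (k := 18) (j := 12) (κ₃ := 1 / 8 - θ / 4) hθ.le (by push_cast; linarith) hε'
      (128 * 116 ^ 2 * (2 * C₀ * Cr)) m
    obtain h₃ := budget_monomial (a := 4) (k := 16) (j := 14) (κ₃ := 1 / 8 - θ / 4) hθ.le (by push_cast; linarith) hε'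
      (128 * 116 ^ 2 * Cr ^ 2) 0
    obtain ⟨β₀, hβ₀, hall⟩ := exists_forall_and h₁ (exists_forall_and h₂ h₃)
    refine ⟨β₀, hβ₀, fun β hβ H hH hHu => ?_⟩
    obtain ⟨e₁, e₂, e₃⟩ := hall β hβ H
    replace e₁ := e₁ hH hHu
    replace e₂ := e₂ hH hHu
    replace e₃ := e₃ hH hHu
    simp only [pow_zero, mul_one] at e₃
    have hβ0 : 0 < β := by linarith
    set s : ℝ := β ^ ((1 / 8 - θ / 4) - 1 / 2) with hs
    have hb2 : β ^ (2 : ℝ) = β ^ 2 := Real.rpow_two β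
    have hb3 : β ^ (3 : ℝ) = β ^ 3 := by rw [← Real.rpow_natCast]; norm_num
    have hb4 : β ^ (4 : ℝ) = β ^ 4 := by rw [← Real.rpow_natCast]; norm_num
    rw [hb2] at e₁
    rw [hb3] at e₂
    rw [hb4] at e₃
    have hid : β ^ 2 * (H : ℝ) ^ 8 * (128 * (116 * s ^ 2) ^ 2 *
        (C₀ * (H : ℝ) ^ 6 * (1 + Real.log H) ^ m * s ^ 3 + Cr * β * (H : ℝ) ^ 4 * s ^ 5) ^ 2) =
        128 * 116 ^ 2 * C₀ ^ 2 * (H : ℝ) ^ 20 * (1 + Real.log H) ^ (2 * m) * s ^ 10 * β ^ 2 +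
          128 * 116 ^ 2 * (2 * C₀ * Cr) * (H : ℝ) ^ 18 * (1 + Real.log H) ^ m * s ^ 12 * β ^ 3 +
          128 * 116 ^ 2 * Cr ^ 2 * (H : ℝ) ^ 16 * s ^ 14 * β ^ 4 := by
      ring
    rw [hid]
    linarith

/-- ★ **Rows R6/7 (the Uᵒ/Uᵉ CROSS term) in the per-row `hKk` currency**, from LEAD g78's ✓`GaussNormalForm.abs_cross_muSet_chartPlaqCost_tiltU_parity_le`
(`K := 2`, `τ := 1/2`): `q₆ := 0`, `K₆ β H :=` LEAD's right-hand side at `s = β^{(1/8−θ/4)−1/2}`; side conditions by ✓`side_budget`.  Budget: with the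
eventual dominations `H¹²s⁶, H⁸s⁸ ≤ H⁴/β` and `≤ H⁸/β²` (rows `13θ/2 < 5/4`, `2θ < 2`, `5θ/2 < 1/4`, `0 < 1 + 2θ`) the bound is
`≤ C·L^m·s²·(12^{1/4}·s^{3/2}·H/β + √3·H²/β²)·√3·H⁴/β`, i.e. the two monomials `H¹³L^m s^{7/2}` (`97θ/8 < 21/16`, θ < 0.108) and `H¹⁴L^m s²/β`
(`27θ/2 < 7/4`) after `×β²H⁸`. -/
theorem rowBound_R67 : ∀ θ : ℝ, 0 < θ → θ < 1 / 10 → ∃ q : ℝ, ∃ K : ℝ → ℕ → ℝ,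
    (∃ β₀ : ℝ, 1 ≤ β₀ ∧ ∀ β : ℝ, β₀ ≤ β → ∀ H : ℕ, 1 ≤ H → β ^ θ ≤ (H : ℝ) → (H : ℝ) ≤ β ^ θ + 1 →
      ∀ D : Set (LandauFree H → E3), MeasurableSet D → D ⊆ smallField H (β ^ ((1 / 8 - θ / 4) - 1 / 2)) → (∀ a, -a ∈ D ↔ a ∈ D) →
      gaussAvg β H (fun a => 1 - D.indicator (fun _ => (1 : ℝ)) a) ≤ β ^ (-q) →
      gaussAvg β H (fun a => 1 - D.indicator (fun _ => (1 : ℝ)) a) ≤ 1 / 2 → (∀ a ∈ D, |tiltU β H a| ≤ 2) → ∀ x y : Site 4,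
      let μD : Measure (LandauFree H → E3) := ((volume : Measure (LandauFree H → E3)).restrict D).withDensity fun a => ENNReal.ofReal (gaussWeight β H a)
      let Uo : (LandauFree H → E3) → ℝ := fun a => (tiltU β H a - tiltU β H (-a)) / 2
      let Ue : (LandauFree H → E3) → ℝ := fun a => (tiltU β H a + tiltU β H (-a)) / 2
      let X : (LandauFree H → E3) → ℝ := chartPlaqCost H x 1 2
      let Y : (LandauFree H → E3) → ℝ := chartPlaqCost H y 1 2
      let EO : ((LandauFree H → E3) → ℝ) → ℝ := fun G => Tilt.tiltExp μD Uo 0 G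
      |EO (fun a => (X a - EO X) * (Y a - EO Y) * (Uo a - EO Uo) * (Ue a - EO Ue)) - EO (fun a => (X a - EO X) * (Y a - EO Y)) * EO (fun a => (Uo a - EO Uo) * (Ue a - EO Ue))
          - EO (fun a => (X a - EO X) * (Uo a - EO Uo)) * EO (fun a => (Y a - EO Y) * (Ue a - EO Ue))
          - EO (fun a => (X a - EO X) * (Ue a - EO Ue)) * EO (fun a => (Y a - EO Y) * (Uo a - EO Uo))| ≤ K β H) ∧
    (∀ ε : ℝ, 0 < ε → ∃ β₀ : ℝ, 1 ≤ β₀ ∧ ∀ β : ℝ, β₀ ≤ β → ∀ H : ℕ, 1 ≤ H → (H : ℝ) ≤ β ^ θ + 1 → β ^ 2 * (H : ℝ) ^ 8 * K β H ≤ ε) := by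
  intro θ hθ hθ'
  obtain ⟨C, c₀, m, hC0, hc₀, hR⟩ := GaussNormalForm.abs_cross_muSet_chartPlaqCost_tiltU_parity_le
  obtain ⟨b₀, hb₀, hside⟩ := side_budget (κ₃ := 1 / 8 - θ / 4) (c := c₀) hθ (by linarith) (by linarith) hc₀ 0
  refine ⟨0, fun β H => C * (1 + Real.log H) ^ m * (β ^ ((1 / 8 - θ / 4) - 1 / 2)) ^ 2 *
      (Real.sqrt (Real.sqrt ((β ^ ((1 / 8 - θ / 4) - 1 / 2)) ^ 6 / β ^ 3 * ((2 : ℝ) ^ 2 *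
          ((H : ℝ) ^ 4 / β + (H : ℝ) ^ 12 * (β ^ ((1 / 8 - θ / 4) - 1 / 2)) ^ 6 + (H : ℝ) ^ 8 * (β ^ ((1 / 8 - θ / 4) - 1 / 2)) ^ 8)))) +
        Real.sqrt (((H : ℝ) ^ 4 / β + (H : ℝ) ^ 12 * (β ^ ((1 / 8 - θ / 4) - 1 / 2)) ^ 6 + (H : ℝ) ^ 8 * (β ^ ((1 / 8 - θ / 4) - 1 / 2)) ^ 8) / β ^ 3)) *
      Real.sqrt ((H : ℝ) ^ 8 / β ^ 2 + (H : ℝ) ^ 12 * (β ^ ((1 / 8 - θ / 4) - 1 / 2)) ^ 6 + (H : ℝ) ^ 8 * (β ^ ((1 / 8 - θ / 4) - 1 / 2)) ^ 8),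
    ⟨b₀, hb₀, ?_⟩, ?_⟩
  · intro β hβ H hH hHl hHu D hDm hDs hsym _ hco2 hU x y
    obtain ⟨hH4, hsH, -, -, hs1⟩ := hside β hβ H hH hHl hHu
    have hβ0 : 0 < β := by linarith
    exact hR H hH β hH4 _ (Real.rpow_nonneg hβ0.le _) hs1 hsH D hDm hDs hsym 2 (by norm_num) hU (1 / 2) hco2 le_rfl x y
  · intro ε hε
    have hε' : 0 < ε / 2 := half_pos hε
    -- the four dominations (as `≤ 1` budgets) and the two main monomials
    obtain d₁ := budget_monomial (a := 1) (k := 8) (j := 6) (κ₃ := 1 / 8 - θ / 4) hθ.le (by push_cast; linarith) one_pos 1 0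
    obtain d₂ := budget_monomial (a := 1) (k := 4) (j := 8) (κ₃ := 1 / 8 - θ / 4) hθ.le (by push_cast; linarith) one_pos 1 0
    obtain d₃ := budget_monomial (a := 2) (k := 4) (j := 6) (κ₃ := 1 / 8 - θ / 4) hθ.le (by push_cast; linarith) one_pos 1 0
    obtain d₄ := budget_monomial (a := 2) (k := 0) (j := 8) (κ₃ := 1 / 8 - θ / 4) hθ.le (by push_cast; linarith) one_pos 1 0
    obtain m₁ := budget_monomial (a := 3 / 2 * ((1 / 8 - θ / 4) - 1 / 2)) (k := 13) (j := 2) (κ₃ := 1 / 8 - θ / 4) hθ.le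
      (by push_cast; linarith) hε' (C * ((12 : ℝ) ^ ((1 : ℝ) / 4) * Real.sqrt 3)) m
    obtain m₂ := budget_monomial (a := -1) (k := 14) (j := 2) (κ₃ := 1 / 8 - θ / 4) hθ.le (by push_cast; linarith) hε' (C * 3) m
    obtain ⟨β₀, hβ₀, hall⟩ := exists_forall_and d₁ (exists_forall_and d₂ (exists_forall_and d₃ (exists_forall_and d₄ (exists_forall_and m₁ m₂))))
    refine ⟨β₀, hβ₀, fun β hβ H hH hHu => ?_⟩
    obtain ⟨e₁, e₂, e₃, e₄, f₁, f₂⟩ := hall β hβ H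
    replace e₁ := e₁ hH hHu
    replace e₂ := e₂ hH hHu
    replace e₃ := e₃ hH hHu
    replace e₄ := e₄ hH hHu
    replace f₁ := f₁ hH hHu
    replace f₂ := f₂ hH hHu
    have hβ1 : 1 ≤ β := hβ₀.trans hβ
    have hβ0 : 0 < β := by linarith
    have hH1 : (1 : ℝ) ≤ H := by exact_mod_cast hH
    have hL0 : 0 ≤ 1 + Real.log (H : ℝ) := by have := Real.log_nonneg hH1; linarith
    set s : ℝ := β ^ ((1 / 8 - θ / 4) - 1 / 2) with hs
    have hs0 : 0 ≤ s := by rw [hs]; exact Real.rpow_nonneg hβ0.le _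
    simp only [pow_zero, mul_one, one_mul, Real.rpow_one, Real.rpow_two] at e₁ e₂ e₃ e₄
    rw [Real.rpow_neg_one] at f₂
    -- the dominations in quotient form
    have dom1 : (H : ℝ) ^ 12 * s ^ 6 ≤ (H : ℝ) ^ 4 / β := by
      rw [le_div_iff₀ hβ0]
      calc (H : ℝ) ^ 12 * s ^ 6 * β = (H : ℝ) ^ 4 * ((H : ℝ) ^ 8 * s ^ 6 * β) := by ring
        _ ≤ (H : ℝ) ^ 4 * 1 := mul_le_mul_of_nonneg_left e₁ (by positivity)
        _ = (H : ℝ) ^ 4 := mul_one _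
    have dom2 : (H : ℝ) ^ 8 * s ^ 8 ≤ (H : ℝ) ^ 4 / β := by
      rw [le_div_iff₀ hβ0]
      calc (H : ℝ) ^ 8 * s ^ 8 * β = (H : ℝ) ^ 4 * ((H : ℝ) ^ 4 * s ^ 8 * β) := by ring
        _ ≤ (H : ℝ) ^ 4 * 1 := mul_le_mul_of_nonneg_left e₂ (by positivity)
        _ = (H : ℝ) ^ 4 := mul_one _
    have dom3 : (H : ℝ) ^ 12 * s ^ 6 ≤ (H : ℝ) ^ 8 / β ^ 2 := by
      rw [le_div_iff₀ (pow_pos hβ0 2)]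
      calc (H : ℝ) ^ 12 * s ^ 6 * β ^ 2 = (H : ℝ) ^ 8 * ((H : ℝ) ^ 4 * s ^ 6 * β ^ 2) := by ring
        _ ≤ (H : ℝ) ^ 8 * 1 := mul_le_mul_of_nonneg_left e₃ (by positivity)
        _ = (H : ℝ) ^ 8 := mul_one _
    have dom4 : (H : ℝ) ^ 8 * s ^ 8 ≤ (H : ℝ) ^ 8 / β ^ 2 := by
      rw [le_div_iff₀ (pow_pos hβ0 2)]
      calc (H : ℝ) ^ 8 * s ^ 8 * β ^ 2 = (H : ℝ) ^ 8 * (s ^ 8 * β ^ 2) := by ring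
        _ ≤ (H : ℝ) ^ 8 * 1 := mul_le_mul_of_nonneg_left e₄ (by positivity)
        _ = (H : ℝ) ^ 8 := mul_one _
    have hRUo : (H : ℝ) ^ 4 / β + (H : ℝ) ^ 12 * s ^ 6 + (H : ℝ) ^ 8 * s ^ 8 ≤ 3 * ((H : ℝ) ^ 4 / β) := by linarith
    have hRU : (H : ℝ) ^ 8 / β ^ 2 + (H : ℝ) ^ 12 * s ^ 6 + (H : ℝ) ^ 8 * s ^ 8 ≤ 3 * ((H : ℝ) ^ 8 / β ^ 2) := by linarith
    have hRUo0 : 0 ≤ (H : ℝ) ^ 4 / β + (H : ℝ) ^ 12 * s ^ 6 + (H : ℝ) ^ 8 * s ^ 8 := by positivity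
    have hRU0 : 0 ≤ (H : ℝ) ^ 8 / β ^ 2 + (H : ℝ) ^ 12 * s ^ 6 + (H : ℝ) ^ 8 * s ^ 8 := by positivity
    -- closed forms `y`, `z`, `w` of the three roots after domination
    set y : ℝ := (12 : ℝ) ^ ((1 : ℝ) / 4) * β ^ (3 / 2 * ((1 / 8 - θ / 4) - 1 / 2)) * (H : ℝ) * β⁻¹ with hy
    have hy0 : 0 ≤ y := by positivity
    have hy4 : y ^ 4 = s ^ 6 / β ^ 3 * ((2 : ℝ) ^ 2 * (3 * ((H : ℝ) ^ 4 / β))) := by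
      have h12 : ((12 : ℝ) ^ ((1 : ℝ) / 4)) ^ 4 = 12 := by
        rw [← Real.rpow_natCast, ← Real.rpow_mul (by norm_num)]; norm_num
      have hb : (β ^ (3 / 2 * ((1 / 8 - θ / 4) - 1 / 2))) ^ 4 = s ^ 6 := by
        rw [hs, rpow_pow_eq hβ0.le, rpow_pow_eq hβ0.le]; congr 1; push_cast; ring
      calc y ^ 4 = ((12 : ℝ) ^ ((1 : ℝ) / 4)) ^ 4 * (β ^ (3 / 2 * ((1 / 8 - θ / 4) - 1 / 2))) ^ 4 * (H : ℝ) ^ 4 * β⁻¹ ^ 4 := by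
            rw [hy]; ring
        _ = 12 * s ^ 6 * (H : ℝ) ^ 4 * β⁻¹ ^ 4 := by rw [h12, hb]
        _ = _ := by field_simp; ring
    have hT1 : Real.sqrt (Real.sqrt (s ^ 6 / β ^ 3 * ((2 : ℝ) ^ 2 * ((H : ℝ) ^ 4 / β + (H : ℝ) ^ 12 * s ^ 6 + (H : ℝ) ^ 8 * s ^ 8)))) ≤ y := by
      have hle : s ^ 6 / β ^ 3 * ((2 : ℝ) ^ 2 * ((H : ℝ) ^ 4 / β + (H : ℝ) ^ 12 * s ^ 6 + (H : ℝ) ^ 8 * s ^ 8)) ≤ y ^ 4 := by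
        rw [hy4]; exact mul_le_mul_of_nonneg_left (mul_le_mul_of_nonneg_left hRUo (by norm_num)) (by positivity)
      calc Real.sqrt (Real.sqrt (s ^ 6 / β ^ 3 * ((2 : ℝ) ^ 2 * ((H : ℝ) ^ 4 / β + (H : ℝ) ^ 12 * s ^ 6 + (H : ℝ) ^ 8 * s ^ 8))))
          ≤ Real.sqrt (Real.sqrt (y ^ 4)) := Real.sqrt_le_sqrt (Real.sqrt_le_sqrt hle)
        _ = y := by rw [show y ^ 4 = (y ^ 2) ^ 2 by ring, Real.sqrt_sq (sq_nonneg _), Real.sqrt_sq hy0]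
    set z : ℝ := Real.sqrt 3 * (H : ℝ) ^ 2 * β⁻¹ ^ 2 with hz
    have hz0 : 0 ≤ z := by positivity
    have h3 : Real.sqrt 3 ^ 2 = 3 := Real.sq_sqrt (by norm_num)
    have hT2 : Real.sqrt (((H : ℝ) ^ 4 / β + (H : ℝ) ^ 12 * s ^ 6 + (H : ℝ) ^ 8 * s ^ 8) / β ^ 3) ≤ z := by
      have hle : ((H : ℝ) ^ 4 / β + (H : ℝ) ^ 12 * s ^ 6 + (H : ℝ) ^ 8 * s ^ 8) / β ^ 3 ≤ z ^ 2 := by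
        have hz2 : z ^ 2 = 3 * ((H : ℝ) ^ 4 / β) / β ^ 3 := by
          rw [hz, mul_pow, mul_pow, h3]; field_simp
        rw [hz2]; exact div_le_div_of_nonneg_right hRUo (by positivity)
      calc Real.sqrt (((H : ℝ) ^ 4 / β + (H : ℝ) ^ 12 * s ^ 6 + (H : ℝ) ^ 8 * s ^ 8) / β ^ 3) ≤ Real.sqrt (z ^ 2) := Real.sqrt_le_sqrt hle
        _ = z := Real.sqrt_sq hz0
    set w : ℝ := Real.sqrt 3 * (H : ℝ) ^ 4 * β⁻¹ with hw
    have hw0 : 0 ≤ w := by positivity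
    have hT3 : Real.sqrt ((H : ℝ) ^ 8 / β ^ 2 + (H : ℝ) ^ 12 * s ^ 6 + (H : ℝ) ^ 8 * s ^ 8) ≤ w := by
      have hle : (H : ℝ) ^ 8 / β ^ 2 + (H : ℝ) ^ 12 * s ^ 6 + (H : ℝ) ^ 8 * s ^ 8 ≤ w ^ 2 := by
        have hw2 : w ^ 2 = 3 * ((H : ℝ) ^ 8 / β ^ 2) := by
          rw [hw, mul_pow, mul_pow, h3]; field_simp
        rw [hw2]; exact hRU
      calc Real.sqrt ((H : ℝ) ^ 8 / β ^ 2 + (H : ℝ) ^ 12 * s ^ 6 + (H : ℝ) ^ 8 * s ^ 8) ≤ Real.sqrt (w ^ 2) := Real.sqrt_le_sqrt hle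
        _ = w := Real.sqrt_sq hw0
    -- assemble
    have hK : C * (1 + Real.log H) ^ m * s ^ 2 *
        (Real.sqrt (Real.sqrt (s ^ 6 / β ^ 3 * ((2 : ℝ) ^ 2 * ((H : ℝ) ^ 4 / β + (H : ℝ) ^ 12 * s ^ 6 + (H : ℝ) ^ 8 * s ^ 8)))) +
          Real.sqrt (((H : ℝ) ^ 4 / β + (H : ℝ) ^ 12 * s ^ 6 + (H : ℝ) ^ 8 * s ^ 8) / β ^ 3)) *
        Real.sqrt ((H : ℝ) ^ 8 / β ^ 2 + (H : ℝ) ^ 12 * s ^ 6 + (H : ℝ) ^ 8 * s ^ 8) ≤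
        C * (1 + Real.log H) ^ m * s ^ 2 * (y + z) * w :=
      mul_le_mul (mul_le_mul_of_nonneg_left (add_le_add hT1 hT2) (by positivity)) hT3 (Real.sqrt_nonneg _) (by positivity)
    have hid : β ^ 2 * (H : ℝ) ^ 8 * (C * (1 + Real.log H) ^ m * s ^ 2 * (y + z) * w) =
        C * ((12 : ℝ) ^ ((1 : ℝ) / 4) * Real.sqrt 3) * (H : ℝ) ^ 13 * (1 + Real.log H) ^ m * s ^ 2 * β ^ (3 / 2 * ((1 / 8 - θ / 4) - 1 / 2)) +
          C * 3 * (H : ℝ) ^ 14 * (1 + Real.log H) ^ m * s ^ 2 * β⁻¹ := by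
      have hb : β ^ 2 * β⁻¹ * β⁻¹ = 1 := by field_simp
      have h3' : Real.sqrt 3 * Real.sqrt 3 = 3 := by rw [← sq, h3]
      have step : β ^ 2 * (H : ℝ) ^ 8 * (C * (1 + Real.log H) ^ m * s ^ 2 * (y + z) * w) =
          β ^ 2 * β⁻¹ * β⁻¹ * (C * ((12 : ℝ) ^ ((1 : ℝ) / 4) * Real.sqrt 3) * (H : ℝ) ^ 13 * (1 + Real.log H) ^ m * s ^ 2 *
              β ^ (3 / 2 * ((1 / 8 - θ / 4) - 1 / 2))) +
            β ^ 2 * β⁻¹ * β⁻¹ * (C * (Real.sqrt 3 * Real.sqrt 3) * (H : ℝ) ^ 14 * (1 + Real.log H) ^ m * s ^ 2 * β⁻¹) := by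
        rw [hy, hz, hw]; ring
      rw [step, hb, h3', one_mul, one_mul]
    calc β ^ 2 * (H : ℝ) ^ 8 * (C * (1 + Real.log H) ^ m * s ^ 2 *
          (Real.sqrt (Real.sqrt (s ^ 6 / β ^ 3 * ((2 : ℝ) ^ 2 * ((H : ℝ) ^ 4 / β + (H : ℝ) ^ 12 * s ^ 6 + (H : ℝ) ^ 8 * s ^ 8)))) +
            Real.sqrt (((H : ℝ) ^ 4 / β + (H : ℝ) ^ 12 * s ^ 6 + (H : ℝ) ^ 8 * s ^ 8) / β ^ 3)) *
          Real.sqrt ((H : ℝ) ^ 8 / β ^ 2 + (H : ℝ) ^ 12 * s ^ 6 + (H : ℝ) ^ 8 * s ^ 8))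
        ≤ β ^ 2 * (H : ℝ) ^ 8 * (C * (1 + Real.log H) ^ m * s ^ 2 * (y + z) * w) := mul_le_mul_of_nonneg_left hK (by positivity)
      _ = _ := hid
      _ ≤ ε / 2 + ε / 2 := add_le_add f₁ f₂
      _ = ε := by ring

end K4RowSum

end Summit.QuantumFields.YangMills.Theorems.AllWindowsColdBoxBoxHighLine
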